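import Mathlib
import Summits.ValiantsHypothesis.ValiantsHypothesis.Theorems.DissociatedFixedK.Negative.LoadBearing

/-!
# Crux `TwoProducts` (stmt-5906), line `FrameRungTwo`: planar lemmas for STUB 2 `stub_faceCount`

Crux `TwoProducts` (stmt-ValiantsHypothesis-5906), registered forward line `Cruxes/TwoProducts/Lines/FrameRungTwo.lean`
(rung `FrameRungTwo`), STUB 2 `stub_faceCount` ("provable; planar convex geometry"): the CROSS-FREE vertices of
`conv X` — strictly exposed in `X ⊆ Y₀ ∪ Y₁` by a functional under which no point of `Y₀ ∪ Y₁` lies higher — number at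
most `2 (vert Y₀ + vert Y₁)`.  STUB 1 `stub_classHull` is landed (`…FrameRungTwoClassHull.lean`); STUB 3
`stub_crossCancelCount` is the OPEN core of the rung.  Nothing here bears on the crux `TwoProducts` or on `VP ≠ VNP`.

This file (pure planar geometry over `Fin 2 → ℝ`): a functional in coordinates (`lin_decomp`, `cform`), a point
strictly between two distinct points of `Y` is not a vertex of `conv Y` (`not_mem_extremePoints_of_between`),
LEXICOGRAPHIC MAXIMA ARE VERTICES (`lexmax_mem_extremePoints`: strict exposure by `l + ε · l^⊥`), parallel forms agree
on their common kernel (`form_eq_zero_of_parallel`), parallel vectors (`exists_smul_of_det_eq_zero`), and the 2D sign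
argument `three_directions_absurd`: three pairwise non-parallel directions `d_i` at a point cannot each carry a
supporting functional `L_i` (`L_i(d_i) = 0`, `L_i(d_j) ≤ 0`) — a vertex of a planar convex polygon lies on at most two
edges.  [folklore]
-/

set_option linter.dupNamespace false
set_option linter.unusedSimpArgs false

namespace Summit.ValiantsHypothesis.ValiantsHypothesis.Theorems.NewtonFramesTwoProducts.FrameRungTwoFaceCount

open scoped BigOperators
open Summit.ValiantsHypothesis.ValiantsHypothesis.Theorems.DissociatedFixedK.Negative
  (mem_extremePoints_convexHull_of_strict_sep)

noncomputable section

/-! ## Part 1. Planar lemmas -/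

/-- A linear functional on `ℝ²` in coordinates. -/
theorem lin_decomp (l : (Fin 2 → ℝ) →ₗ[ℝ] ℝ) (x : Fin 2 → ℝ) :
    l x = l (Pi.single 0 1) * x 0 + l (Pi.single 1 1) * x 1 := by
  have hx : x = x 0 • (Pi.single 0 1 : Fin 2 → ℝ) + x 1 • (Pi.single 1 1 : Fin 2 → ℝ) := by
    ext i; fin_cases i <;> simp
  conv_lhs => rw [hx]
  simp only [map_add, map_smul, smul_eq_mul]
  ring

/-- The coordinate form `x ↦ α x₀ + β x₁` as a linear map. -/
def cform (α β : ℝ) : (Fin 2 → ℝ) →ₗ[ℝ] ℝ := α • LinearMap.proj 0 + β • LinearMap.proj 1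

/-- Evaluation of the coordinate form. -/
@[simp] theorem cform_apply (α β : ℝ) (x : Fin 2 → ℝ) : cform α β x = α * x 0 + β * x 1 := by
  simp [cform]

/-- A point strictly inside a segment between two DISTINCT points of `Y` is not an extreme point of `conv Y`. -/
theorem not_mem_extremePoints_of_between {Y : Set (Fin 2 → ℝ)} {x y z : Fin 2 → ℝ} (hx : x ∈ Y) (hy : y ∈ Y)
    (hxy : x ≠ y) (a b : ℝ) (ha : 0 < a) (hb : 0 < b) (hab : a + b = 1) (hz : z = a • x + b • y) :
    z ∉ Set.extremePoints ℝ (convexHull ℝ Y) := by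
  intro hzext
  rw [mem_extremePoints] at hzext
  have hseg : z ∈ openSegment ℝ x y := ⟨a, b, ha, hb, hab, hz.symm⟩
  have h := hzext.2 x (subset_convexHull ℝ Y hx) y (subset_convexHull ℝ Y hy) hseg
  exact hxy (h.1.trans h.2.symm)

/-- Two coordinate systems: if `(α, β) ≠ 0` then `α w₀ + β w₁ = 0` and `-β w₀ + α w₁ = 0` force `w = 0`. -/
theorem eq_zero_of_form_and_rot (α β w₀ w₁ : ℝ) (hαβ : α ≠ 0 ∨ β ≠ 0) (h1 : α * w₀ + β * w₁ = 0)
    (h2 : -β * w₀ + α * w₁ = 0) : w₀ = 0 ∧ w₁ = 0 := by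
  have hpos : 0 < α ^ 2 + β ^ 2 := by
    rcases hαβ with h | h
    · have := sq_pos_of_ne_zero h; positivity
    · have := sq_pos_of_ne_zero h; positivity
  have e0 : (α ^ 2 + β ^ 2) * w₀ = 0 := by linear_combination α * h1 - β * h2
  have e1 : (α ^ 2 + β ^ 2) * w₁ = 0 := by linear_combination β * h1 + α * h2
  exact ⟨by simpa [hpos.ne'] using e0, by simpa [hpos.ne'] using e1⟩

/-- **Lexicographic maxima are vertices.**  If `a ∈ Y` maximises the form `(α, β) ≠ 0` over the finite set `Y` and,
among the maximisers, maximises the rotated form `(-β·s, α·s)` (`s = ±1`), then `a` is an extreme point of `conv Y`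
(strict exposure by `(α, β) + ε · rotated` for small `ε > 0`). -/
theorem lexmax_mem_extremePoints (Y : Finset (Fin 2 → ℝ)) (a : Fin 2 → ℝ) (ha : a ∈ Y) (α β s : ℝ)
    (hαβ : α ≠ 0 ∨ β ≠ 0) (hs : s = 1 ∨ s = -1)
    (h1 : ∀ y ∈ Y, α * y 0 + β * y 1 ≤ α * a 0 + β * a 1)
    (h2 : ∀ y ∈ Y, α * y 0 + β * y 1 = α * a 0 + β * a 1 →
      s * (-β * y 0 + α * y 1) ≤ s * (-β * a 0 + α * a 1)) :
    a ∈ Set.extremePoints ℝ (convexHull ℝ (Y : Set (Fin 2 → ℝ))) := by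
  classical
  -- notation
  set f : (Fin 2 → ℝ) → ℝ := fun y => α * y 0 + β * y 1 with hf
  set g : (Fin 2 → ℝ) → ℝ := fun y => s * (-β * y 0 + α * y 1) with hg
  set Ylt := Y.filter (fun y => f y < f a) with hYlt
  set φ : (Fin 2 → ℝ) → ℝ := fun y => (f a - f y) / (|g y - g a| + 1) with hφ
  have hφpos : ∀ y ∈ Ylt, 0 < φ y := by
    intro y hy
    have : f y < f a := (Finset.mem_filter.mp hy).2
    exact div_pos (by linarith) (by positivity)
  -- the perturbation size
  obtain ⟨ε, hεpos, hεle⟩ : ∃ ε : ℝ, 0 < ε ∧ ∀ y ∈ Ylt, ε ≤ φ y := by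
    by_cases hne : Ylt.Nonempty
    · exact ⟨Ylt.inf' hne φ, (Finset.lt_inf'_iff hne).mpr hφpos, fun y hy => Finset.inf'_le φ hy⟩
    · exact ⟨1, one_pos, fun y hy => absurd ⟨y, hy⟩ hne⟩
  -- the strictly exposing functional `f + ε g`
  refine mem_extremePoints_convexHull_of_strict_sep (Finset.mem_coe.mpr ha)
    (cform (α + ε * (s * -β)) (β + ε * (s * α))) fun y hy hne => ?_
  have hyY : y ∈ Y := Finset.mem_coe.mp hy
  have hval : ∀ z : Fin 2 → ℝ, cform (α + ε * (s * -β)) (β + ε * (s * α)) z = f z + ε * g z := by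
    intro z; simp only [cform_apply, hf, hg]; ring
  rw [hval, hval]
  rcases (h1 y hyY).lt_or_eq with hlt | heq
  · -- `f y < f a`: the perturbation is dominated
    have hyl : y ∈ Ylt := Finset.mem_filter.mpr ⟨hyY, hlt⟩
    have hε := hεle y hyl
    have hden : 0 < |g y - g a| + 1 := by positivity
    have hb : ε * (|g y - g a| + 1) ≤ f a - f y := by
      have := (le_div_iff₀ hden).mp hε
      linarith
    have habs : ε * (g y - g a) ≤ ε * |g y - g a| := mul_le_mul_of_nonneg_left (le_abs_self _) hεpos.le
    nlinarith
  · -- `f y = f a`: then `g y < g a` strictly (independence pins equality to `y = a`)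
    have hgy : g y ≤ g a := h2 y hyY heq
    rcases hgy.lt_or_eq with hglt | hgeq
    · nlinarith
    · exfalso
      apply hne
      have hs0 : s ≠ 0 := by rcases hs with h | h <;> rw [h] <;> norm_num
      have heq' : α * y 0 + β * y 1 = α * a 0 + β * a 1 := heq
      have hgeq' : s * (-β * y 0 + α * y 1) = s * (-β * a 0 + α * a 1) := hgeq
      have e1 : α * (y 0 - a 0) + β * (y 1 - a 1) = 0 := by linarith
      have e2 : -β * (y 0 - a 0) + α * (y 1 - a 1) = 0 := by
        have := mul_left_cancel₀ hs0 hgeq'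
        linarith
      obtain ⟨h0, h1'⟩ := eq_zero_of_form_and_rot α β _ _ hαβ e1 e2
      funext i; fin_cases i
      · show y 0 = a 0; linarith
      · show y 1 = a 1; linarith

/-- Parallel functionals: two forms vanishing on the same non-zero vector `d` agree on every vector the first
(non-zero) one vanishes on. -/
theorem form_eq_zero_of_parallel (α β α' β' d₀ d₁ w₀ w₁ : ℝ) (hαβ : α ≠ 0 ∨ β ≠ 0) (hd : d₀ ≠ 0 ∨ d₁ ≠ 0)
    (h1 : α * d₀ + β * d₁ = 0) (h2 : α' * d₀ + β' * d₁ = 0) (hw : α * w₀ + β * w₁ = 0) :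
    α' * w₀ + β' * w₁ = 0 := by
  have hdpos : 0 < d₀ ^ 2 + d₁ ^ 2 := by
    rcases hd with h | h
    · have := sq_pos_of_ne_zero h; positivity
    · have := sq_pos_of_ne_zero h; positivity
  have hdet : α * β' - β * α' = 0 := by
    have e : (α * β' - β * α') * (d₀ ^ 2 + d₁ ^ 2) = 0 := by
      linear_combination (β' * d₀ - α' * d₁) * h1 + (-β * d₀ + α * d₁) * h2
    rcases mul_eq_zero.mp e with h | h
    · exact h
    · exact absurd h hdpos.ne'
  have hpos : 0 < α ^ 2 + β ^ 2 := by
    rcases hαβ with h | h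
    · have := sq_pos_of_ne_zero h; positivity
    · have := sq_pos_of_ne_zero h; positivity
  have e : (α ^ 2 + β ^ 2) * (α' * w₀ + β' * w₁) = 0 := by
    linear_combination (α * α' + β * β') * hw + (α * w₁ - β * w₀) * hdet
  rcases mul_eq_zero.mp e with h | h
  · exact absurd h hpos.ne'
  · exact h

/-- Parallel vectors: if `det(d, d') = 0` with `d ≠ 0` then `d' = μ d`. -/
theorem exists_smul_of_det_eq_zero (d₀ d₁ e₀ e₁ : ℝ) (hd : d₀ ≠ 0 ∨ d₁ ≠ 0) (hdet : d₀ * e₁ - d₁ * e₀ = 0) :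
    ∃ μ : ℝ, e₀ = μ * d₀ ∧ e₁ = μ * d₁ := by
  rcases hd with h | h
  · exact ⟨e₀ / d₀, by field_simp, by field_simp; linarith⟩
  · exact ⟨e₁ / d₁, by field_simp; linarith, by field_simp⟩

/-- **At most two face directions at a vertex** (the 2D sign argument).  Three non-zero pairwise non-parallel
directions `d_i` with forms `L_i ≠ 0` such that `L_i(d_i) = 0` and `L_i(d_j) ≤ 0` cannot exist. -/
theorem three_directions_absurd (a1 b1 a2 b2 a3 b3 x1 y1 x2 y2 x3 y3 : ℝ)
    (hL1 : a1 ≠ 0 ∨ b1 ≠ 0) (hL2 : a2 ≠ 0 ∨ b2 ≠ 0) (hL3 : a3 ≠ 0 ∨ b3 ≠ 0)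
    (hd1 : x1 ≠ 0 ∨ y1 ≠ 0) (hd2 : x2 ≠ 0 ∨ y2 ≠ 0) (hd3 : x3 ≠ 0 ∨ y3 ≠ 0)
    (hD12 : x1 * y2 - y1 * x2 ≠ 0) (hD13 : x1 * y3 - y1 * x3 ≠ 0) (hD23 : x2 * y3 - y2 * x3 ≠ 0)
    (h11 : a1 * x1 + b1 * y1 = 0) (h22 : a2 * x2 + b2 * y2 = 0) (h33 : a3 * x3 + b3 * y3 = 0)
    (h12 : a1 * x2 + b1 * y2 ≤ 0) (h13 : a1 * x3 + b1 * y3 ≤ 0)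
    (h21 : a2 * x1 + b2 * y1 ≤ 0) (h23 : a2 * x3 + b2 * y3 ≤ 0)
    (h31 : a3 * x1 + b3 * y1 ≤ 0) (h32 : a3 * x2 + b3 * y2 ≤ 0) : False := by
  -- squared norms
  have hn1pos : 0 < x1 ^ 2 + y1 ^ 2 := by
    rcases hd1 with h | h
    · have := sq_pos_of_ne_zero h; positivity
    · have := sq_pos_of_ne_zero h; positivity
  have hn2pos : 0 < x2 ^ 2 + y2 ^ 2 := by
    rcases hd2 with h | h
    · have := sq_pos_of_ne_zero h; positivity
    · have := sq_pos_of_ne_zero h; positivity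
  have hn3pos : 0 < x3 ^ 2 + y3 ^ 2 := by
    rcases hd3 with h | h
    · have := sq_pos_of_ne_zero h; positivity
    · have := sq_pos_of_ne_zero h; positivity
  -- ν_i := b_i x_i - a_i y_i ≠ 0
  have hν1 : b1 * x1 - a1 * y1 ≠ 0 := by
    intro h0
    have ea : a1 * (x1 ^ 2 + y1 ^ 2) = 0 := by linear_combination x1 * h11 - y1 * h0
    have eb : b1 * (x1 ^ 2 + y1 ^ 2) = 0 := by linear_combination y1 * h11 + x1 * h0
    rcases hL1 with h | h
    · exact h (by simpa [hn1pos.ne'] using ea)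
    · exact h (by simpa [hn1pos.ne'] using eb)
  have hν2 : b2 * x2 - a2 * y2 ≠ 0 := by
    intro h0
    have ea : a2 * (x2 ^ 2 + y2 ^ 2) = 0 := by linear_combination x2 * h22 - y2 * h0
    have eb : b2 * (x2 ^ 2 + y2 ^ 2) = 0 := by linear_combination y2 * h22 + x2 * h0
    rcases hL2 with h | h
    · exact h (by simpa [hn2pos.ne'] using ea)
    · exact h (by simpa [hn2pos.ne'] using eb)
  have hν3 : b3 * x3 - a3 * y3 ≠ 0 := by
    intro h0
    have ea : a3 * (x3 ^ 2 + y3 ^ 2) = 0 := by linear_combination x3 * h33 - y3 * h0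
    have eb : b3 * (x3 ^ 2 + y3 ^ 2) = 0 := by linear_combination y3 * h33 + x3 * h0
    rcases hL3 with h | h
    · exact h (by simpa [hn3pos.ne'] using ea)
    · exact h (by simpa [hn3pos.ne'] using eb)
  -- the identities |d_i|² L_i(d_j) = ν_i D_ij
  have i12 : (x1 ^ 2 + y1 ^ 2) * (a1 * x2 + b1 * y2) = (b1 * x1 - a1 * y1) * (x1 * y2 - y1 * x2) := by
    linear_combination (x1 * x2 + y1 * y2) * h11
  have i13 : (x1 ^ 2 + y1 ^ 2) * (a1 * x3 + b1 * y3) = (b1 * x1 - a1 * y1) * (x1 * y3 - y1 * x3) := by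
    linear_combination (x1 * x3 + y1 * y3) * h11
  have i21 : (x2 ^ 2 + y2 ^ 2) * (a2 * x1 + b2 * y1) = (b2 * x2 - a2 * y2) * (-(x1 * y2 - y1 * x2)) := by
    linear_combination (x2 * x1 + y2 * y1) * h22
  have i23 : (x2 ^ 2 + y2 ^ 2) * (a2 * x3 + b2 * y3) = (b2 * x2 - a2 * y2) * (x2 * y3 - y2 * x3) := by
    linear_combination (x2 * x3 + y2 * y3) * h22
  have i31 : (x3 ^ 2 + y3 ^ 2) * (a3 * x1 + b3 * y1) = (b3 * x3 - a3 * y3) * (-(x1 * y3 - y1 * x3)) := by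
    linear_combination (x3 * x1 + y3 * y1) * h33
  have i32 : (x3 ^ 2 + y3 ^ 2) * (a3 * x2 + b3 * y2) = (b3 * x3 - a3 * y3) * (-(x2 * y3 - y2 * x3)) := by
    linear_combination (x3 * x2 + y3 * y2) * h33
  set ν1 := b1 * x1 - a1 * y1 with hν1d
  set ν2 := b2 * x2 - a2 * y2 with hν2d
  set ν3 := b3 * x3 - a3 * y3 with hν3d
  set D12 := x1 * y2 - y1 * x2 with hD12d
  set D13 := x1 * y3 - y1 * x3 with hD13d
  set D23 := x2 * y3 - y2 * x3 with hD23d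
  -- signs: ν_i D_ij < 0
  have sgn : ∀ (n L ν D : ℝ), 0 < n → L ≤ 0 → n * L = ν * D → ν ≠ 0 → D ≠ 0 → ν * D < 0 := by
    intro n L ν D hn hL hid hν hD
    have hle : ν * D ≤ 0 := by rw [← hid]; exact mul_nonpos_of_nonneg_of_nonpos hn.le hL
    exact lt_of_le_of_ne hle (mul_ne_zero hν hD)
  have s12 := sgn _ _ _ _ hn1pos h12 i12 hν1 hD12
  have s13 := sgn _ _ _ _ hn1pos h13 i13 hν1 hD13
  have s21 := sgn _ _ _ _ hn2pos h21 i21 hν2 (neg_ne_zero.mpr hD12)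
  have s23 := sgn _ _ _ _ hn2pos h23 i23 hν2 hD23
  have s31 := sgn _ _ _ _ hn3pos h31 i31 hν3 (neg_ne_zero.mpr hD13)
  have s32 := sgn _ _ _ _ hn3pos h32 i32 hν3 (neg_ne_zero.mpr hD23)
  -- products of two negatives with the same ν are positive
  have pp : ∀ (ν A B : ℝ), ν ≠ 0 → ν * A < 0 → ν * B < 0 → 0 < A * B := by
    intro ν A B hν hA hB
    have h := mul_pos_of_neg_of_neg hA hB
    have hνsq : 0 < ν ^ 2 := by positivity
    have h' : 0 < ν ^ 2 * (A * B) := by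
      have : ν * A * (ν * B) = ν ^ 2 * (A * B) := by ring
      rw [this] at h; exact h
    exact (mul_pos_iff_of_pos_left hνsq).mp h'
  have p1 : 0 < D12 * D13 := pp ν1 _ _ hν1 s12 s13
  have p2 : 0 < (-D12) * D23 := pp ν2 _ _ hν2 s21 s23
  have p3 : 0 < (-D13) * (-D23) := pp ν3 _ _ hν3 s31 s32
  have p3' : 0 < D13 * D23 := by
    have e : (-D13) * (-D23) = D13 * D23 := by ring
    rw [e] at p3
    exact p3
  have p4 : 0 < D13 ^ 2 * (D12 * D23) := by
    have h := mul_pos p1 p3'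
    have : D12 * D13 * (D13 * D23) = D13 ^ 2 * (D12 * D23) := by ring
    rw [this] at h; exact h
  have hD13sq : 0 < D13 ^ 2 := by positivity
  have p5 : 0 < D12 * D23 := (mul_pos_iff_of_pos_left hD13sq).mp p4
  have : (-D12) * D23 = -(D12 * D23) := by ring
  rw [this] at p2
  linarith


end

end Summit.ValiantsHypothesis.ValiantsHypothesis.Theorems.NewtonFramesTwoProducts.FrameRungTwoFaceCount
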